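import Summits.BirchSwinnertonDyer.BirchSwinnertonDyer.Theorems.PrintCf2RubinValueTwoRowTwoLevelCohKummer
import Summits.BirchSwinnertonDyer.BirchSwinnertonDyer.Theorems.PrintCf2RubinValueTwoRowTwoTwistedKummerLaws
import Summits.BirchSwinnertonDyer.BirchSwinnertonDyer.Theorems.PrintCf2RubinValueTwoRowTwoTwistedKummerRoots
import Summits.BirchSwinnertonDyer.BirchSwinnertonDyer.Theorems.PrintCf2RubinValueTwoRowTwoLevelTorsion
import Summits.BirchSwinnertonDyer.BirchSwinnertonDyer.Theorems.PrintCf2RubinValueTwoTwistedKummerScalar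
import Literature.NumberTheory.GaloisRepresentations.UnramifiedRadicalDescentSUnits
import HarnessLib

/-!
# M-LINE-PIN / (α3) ROW 2, FILE 8b: a `k`-TOWER of classes of `H¹(G_S(F), μ_{p^k} ⊗ θ′)` consists of twisted Kummer
# classes of roots of `S`-UNITS of `F` (the `Cl_S(F)`-term of the Kummer sequence dies in `lim←_k`)

Cell `bsd-print-cf2`, WIDTH seat `bsd-line-cf2-p1-w6` g10 (prover-bsd-line-cf2-p1-w6-g10-0), successor of g9 on (α3) ROW 2 of the JLK road on the
DECIDING child stmt-BirchSwinnertonDyer-24721 `PrintCf2RubinValueTwo.MainConjClauseAtSplitTwoQuadDA` (memo `HOME/bsd-line-cf2-p1-w6/ROW2-RHO3-SPEC-w6g9.md`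
§2 (C-a2)+(C-b), §4: the first step of the COKERNEL half `hgcoker` of g8's FILE 4a); `--supports` that item (helper, Theses-free). HONEST FRAMING:
Kummer theory plus the class-number finiteness of the level (tree `UnramifiedRadicalDescentSUnits`, this seat); nothing here closes the crux or a
registered stub; no summit statement is proved by this seat; BSD is not proved by any of this. THEOREMS ONLY (no definition, no named fact, no
instance, no `sorry`).

WHAT. `U = Gal(K̄/F)`, `F ⊆ K_S` a number field containing `K` (`N_S ≤ U`), `θ′|_U = 1`, `S ⊇ {v ∣ p}`. A `k`-TOWER is a sequence
`y_k ∈ H¹(G_S(F), μ_{p^k} ⊗ θ′)` with `red(y_{k+1}) = y_k` (the transition `ζ ↦ ζ^p`; e.g. `k ↦ res_F (I.proj n k h)` for `h` in ty2's pinned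
`H¹(𝒪_K[1/p𝔣], Λ(θ′)(1))`, (P2)).
* §2 THE ENGINE (`exists_isTwistedKummerClass_root_of_forall_dvd`): if for EVERY depth `j` the class `y_j` is the class of a radical `β_j ∈ K_S` with
  `b_j = β_j^{p^j} ∈ F^×` whose divisor OFF a set `T` of places of `F` is divisible by `p^j`, then every `y_k` is the class of a root of a `T`-UNIT of `F`:
  with `#Cl(𝓞_F) = p^t h'`, `p ∤ h'`, read the hypothesis at depth `k + t`; `b^{h} = a^{p^{k+t}}·ε₀` (`ε₀` a `T`-unit; the ideal `∏_{w ∉ T} w^{ord_w b/p^{k+t}}`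
  to the `h`, tree `exists_eq_pow_mul_of_forall_dvd_log_valuation`), so `x = b^{h'}/a^{p^k}` has `x^{p^t} = ε₀` and is a `T`-unit; `y_k = red^t(y_{k+t})`
  is the class of `β^{p^t}` (FILE 3c), `h'·y_k` that of `β^{p^t h'}/a`, a root of `x`; and `y_k = (m h')·y_k` with `m h' ≡ 1 (p^k)` (`p^k·H¹ = 0`,
  FILE 3b). No class-number multiplier survives: the `Cl_T(F)`-obstruction of `y_k` is `p^t`·(that of `y_{k+t}`), killed by `h'`.
* §3 (`exists_sUnit_isTwistedKummerClass_of_tower`): the hypothesis of §2 for `T = {w : w ∣ S}` holds for EVERY tower — `y_j` is the class of some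
  `β_j ∈ K_S` with `b_j = β_j^{p^j} ∈ F` (FILE 7a, Hilbert 90) and `p^j ∣ ord_w b_j` off `S` because `F(β_j)/F` is unramified there (tree
  `dvd_log_valuation_of_pow_eq_of_forall_smul_eq`). So every `y_k` is the class of a root of an `S`-UNIT.
§1: small laws (iterated reduction; `(N·M)·y = y` for `N·M ≡ 1 (p^k)`); powers / constants / inverses are -w5 g10's `TwistedKummerScalar`. FILE 8c feeds §2 with `T = {w ∣ p}` once the ramified places `𝔩 ∣ 𝔣`,
`𝔩 ∤ p` are handled by the `θ′`-eigen condition (memo (C-e)).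

presearch: «Kummer sequence 0 → 𝒪_{F,S}^×/p^k → H¹(G_S(F), μ_{p^k}) → Cl_S(F)[p^k] → 0» → NSW (8.3.4) [corpus: NeukirchSchmidtWingberg2008 VIII §3];
JLK 2011 Cor. 3.4 `𝒪_{K(𝔪)}[1/p]^× ⊗ ℤ_p ⊂ H¹(𝒪_{K(𝔪)}[1/p], ℤ_p(1))` [corpus: arXiv 0804.2828 p0010:L40–46] (the `⊗ ℤ_p` statement is exactly the
`lim←_k` reading). beyond-print theorem: no.

References: J. Neukirch, A. Schmidt, K. Wingberg, *Cohomology of Number Fields* (2008) VIII §3 Prop. (8.3.4); J. Johnson-Leung, G. Kings, J. reine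
angew. Math. 653 (2011) §3.3, Cor. 3.4; J.-P. Serre, *Local Fields* (1979) X §3 b).
-/

noncomputable section

open scoped Classical

-- the summit namespace `Summit.BirchSwinnertonDyer.BirchSwinnertonDyer` repeats the problem name by design (D-0017)
set_option linter.dupNamespace false
set_option autoImplicit false

open scoped NumberField
open Field IsDedekindDomain IntermediateField WithZero
open Literature.NumberTheory.GaloisRepresentations Literature.NumberTheory.GaloisRepresentations.DiscreteGaloisModule
open Literature.NumberTheory.GaloisRepresentations.LocalWeilDatum
open Literature.NumberTheory.ComplexMultiplication.EllipticUnits.JohnsonLeungKings2011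

namespace Summit.BirchSwinnertonDyer.BirchSwinnertonDyer.Theorems.PrintCf2.RowTwo

variable {K : Type} [Field K] [NumberField K] (p : ℕ) [Fact p.Prime] (S : Set (HeightOneSpectrum (𝓞 K)))
  (θ : absoluteGaloisGroup K →ₜ* ℤ_[p]ˣ) (k : ℕ) (U : Subgroup (absoluteGaloisGroup K))

/-! ## §1. Two small laws: iterated reduction, `(N·M)·y = y` -/

omit [NumberField K] in
/-- **Iterated reduction along a `k`-tower**: if `red(y_{j+1}) = y_j` for all `j` and `y_{k+t}` is a class of `β`, then `y_k` is a class of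
`β^{p^t}` (FILE 3c's `isTwistedKummerClass_levelRed`, `t` times). [cite: Kato2004Asterisque, §8.2 (p. 180)] [cite: JohnsonLeungKings2011, §3.3 (5)–(6)] -/
theorem isTwistedKummerClass_levelRed_iterate (y : ∀ k : ℕ, levelCoh p S θ U k 1)
    (hy : ∀ k, levelRed p S θ U k 1 (y (k + 1)) = y k) (t : ℕ) :
    ∀ (k : ℕ) (β : (AlgebraicClosure K)ˣ), IsTwistedKummerClass p θ S U (k + t) β (y (k + t)) →
      IsTwistedKummerClass p θ S U k (β ^ p ^ t) (y k) := by
  induction t with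
  | zero => intro k β h; rwa [pow_zero, pow_one]
  | succ t ih =>
    intro k β h
    have h1 : IsTwistedKummerClass p θ S U (k + t) (β ^ p) (y (k + t)) := by
      rw [← hy (k + t)]
      exact isTwistedKummerClass_levelRed p S θ U (k + t) h
    have h2 := ih k (β ^ p) h1
    rwa [← pow_mul, ← pow_succ'] at h2

omit [NumberField K] in
/-- **`(N·M)·y = y`** on `H¹(·, μ_{p^k} ⊗ θ′)` when `N·M ≡ 1 (mod p^k)` (`p^k` kills the group, FILE 3b). [folklore] -/
theorem mul_nsmul_levelCoh_eq_self {N M : ℕ} (hNM : ((N : ZMod (p ^ k)) * (M : ZMod (p ^ k))) = 1) (y : levelCoh p S θ U k 1) :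
    (N * M) • y = y := by
  have hx : (p ^ k) • y = 0 := nsmul_levelCoh_one_eq_zero p S θ U k y
  have hmod : (N * M) % p ^ k = 1 % p ^ k := by
    rw [← ZMod.natCast_eq_natCast_iff', Nat.cast_mul, hNM, Nat.cast_one]
  have key : ∀ n : ℕ, n • y = (n % p ^ k) • y := fun n ↦ by
    conv_lhs => rw [← Nat.mod_add_div n (p ^ k), add_nsmul, mul_nsmul, hx, nsmul_zero, add_zero]
  rw [key, hmod, ← key, one_nsmul]

/-! ## §2. The engine: per-depth divisibility of the divisor off `T` ⟹ classes of roots of `T`-units -/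

omit [NumberField K] in
/-- **THE `lim←_k` ENGINE.** `F ⊆ K̄` a number field containing `K` with `N_S ≤ Gal(K̄/F)`, `T` any set of finite places of `F`, `(y_k)_k` a tower (`red(y_{k+1}) = y_k`). IF for every depth `j` the class `y_j` is the twisted Kummer class of some
`β_j ∈ K̄ˣ` fixed by `N_S` whose `p^j`-th power is some `b_j ∈ F^×` with `p^j ∣ ord_w(b_j)` for all `w ∉ T`, THEN every `y_k` is the class of an
`N_S`-fixed `β` with `β^{p^k} = ε ∈ F^×`, `ε` a `T`-UNIT (`w.valuation F ε = 1` for `w ∉ T`). Proof in the module docstring (§2): depth `k + t`,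
`#Cl(𝓞_F) = p^t h'`; the class-number multiplier is absorbed because `p ∤ h'` and `p^k` kills `H¹`.
[cite: NeukirchSchmidtWingberg2008, VIII §3 Prop. (8.3.4)] [cite: JohnsonLeungKings2011, Cor. 3.4 (arXiv p0010:L40–46)] -/
theorem exists_isTwistedKummerClass_root_of_forall_dvd
    (F : IntermediateField K (AlgebraicClosure K)) [NumberField F]
    (hNF : ramificationSubgroup K S ≤ galFixing K F) (T : Set (HeightOneSpectrum (𝓞 F)))
    (y : ∀ k : ℕ, levelCoh p S θ (galFixing K F) k 1) (hy : ∀ k, levelRed p S θ (galFixing K F) k 1 (y (k + 1)) = y k)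
    (hdiv : ∀ j : ℕ, ∃ (β : (AlgebraicClosure K)ˣ) (b : F), b ≠ 0 ∧ (β : AlgebraicClosure K) ^ p ^ j = (b : AlgebraicClosure K) ∧
      (∀ τ ∈ ramificationSubgroup K S, τ • β = β) ∧ IsTwistedKummerClass p θ S (galFixing K F) j β (y j) ∧
      ∀ w : HeightOneSpectrum (𝓞 F), w ∉ T → ((p ^ j : ℕ) : ℤ) ∣ log (w.valuation F b)) (k : ℕ) :
    ∃ (ε : F) (β : (AlgebraicClosure K)ˣ), ε ≠ 0 ∧ (∀ w : HeightOneSpectrum (𝓞 F), w ∉ T → w.valuation F ε = 1) ∧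
      (β : AlgebraicClosure K) ^ p ^ k = (ε : AlgebraicClosure K) ∧ (∀ τ ∈ ramificationSubgroup K S, τ • β = β) ∧
      IsTwistedKummerClass p θ S (galFixing K F) k β (y k) := by
  have hp : p.Prime := Fact.out
  -- `#Cl(𝓞 F) = p^t h'`
  set h : ℕ := Fintype.card (ClassGroup (𝓞 F)) with hh
  have hh0 : h ≠ 0 := Fintype.card_ne_zero
  set t : ℕ := h.factorization p with ht
  set h' : ℕ := h / p ^ t with hh'
  have hdecomp : p ^ t * h' = h := Nat.ordProj_mul_ordCompl_eq_self h p
  have hndvd : ¬ p ∣ h' := Nat.not_dvd_ordCompl hp hh0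
  -- depth `k + t`
  obtain ⟨β₀, b₀, hb₀ne, hb₀, hβ₀N, hc₀, hdvd⟩ := hdiv (k + t)
  obtain ⟨a, ε₀, ha0, hε₀0, hε₀T, hbε⟩ := exists_eq_pow_mul_of_forall_dvd_log_valuation T (p ^ (k + t)) hb₀ne hdvd
  -- `x = b₀^{h'} · a^{-p^k}`, `x^{p^t} = ε₀`, a `T`-unit
  set x : F := b₀ ^ h' * (a ^ p ^ k)⁻¹ with hxdef
  have hx0 : x ≠ 0 := mul_ne_zero (pow_ne_zero _ hb₀ne) (inv_ne_zero (pow_ne_zero _ ha0))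
  have hxpow : x ^ p ^ t = ε₀ := by
    have h1 : b₀ ^ h = (a ^ p ^ k) ^ p ^ t * ε₀ := by rw [hh, hbε, ← pow_mul, ← pow_add]
    rw [hxdef, mul_pow, ← pow_mul, mul_comm h' (p ^ t), hdecomp, h1, inv_pow, mul_comm ((a ^ p ^ k) ^ p ^ t) ε₀,
      mul_inv_cancel_right₀ (pow_ne_zero _ (pow_ne_zero _ ha0))]
  have hxT : ∀ w : HeightOneSpectrum (𝓞 F), w ∉ T → w.valuation F x = 1 := by
    intro w hw
    have hx0' : w.valuation F x ≠ 0 := (Valuation.ne_zero_iff _).2 hx0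
    have h1 : log (w.valuation F x ^ p ^ t) = 0 := by rw [← map_pow, hxpow, hε₀T w hw, log_one]
    rw [log_pow, nsmul_eq_mul] at h1
    have h2 : log (w.valuation F x) = 0 := by
      rcases mul_eq_zero.mp h1 with h3 | h3
      · exact absurd (by exact_mod_cast h3 : p ^ t = 0) (pow_ne_zero t hp.ne_zero)
      · exact h3
    rw [← exp_log hx0', h2, exp_zero]
  have hbx : b₀ ^ h' = a ^ p ^ k * x := by rw [hxdef, mul_left_comm, mul_inv_cancel₀ (pow_ne_zero _ ha0), mul_one]
  -- `y_k` is the class of `β₁ = β₀^{p^t}`; `h'·y_k` that of `β₁^{h'}·a⁻¹`, a root of `x`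
  have hc₁ : IsTwistedKummerClass p θ S (galFixing K F) k (β₀ ^ p ^ t) (y k) :=
    isTwistedKummerClass_levelRed_iterate p S θ (galFixing K F) y hy t k β₀ hc₀
  have haK0 : (a : AlgebraicClosure K) ≠ 0 := fun h0 ↦ ha0 (by exact_mod_cast h0)
  let aK : (AlgebraicClosure K)ˣ := Units.mk0 (a : AlgebraicClosure K) haK0
  have haKF : (aK : AlgebraicClosure K) ∈ F := a.2
  have hc₂ : IsTwistedKummerClass p θ S (galFixing K F) k ((β₀ ^ p ^ t) ^ h' * aK⁻¹) (h' • y k) := by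
    have h1 := isTwistedKummerClass_mul p S θ (galFixing K F) k (TwistedZeta.isTwistedKummerClass_pow p S θ k (galFixing K F) hc₁ h')
      (TwistedZeta.isTwistedKummerClass_zero_of_forall_smul_eq p S θ k (galFixing K F) (η := aK⁻¹) fun σ hσ ↦ by
        rw [smul_inv', smul_units_eq_self_of_mem_galFixing hσ haKF])
    rwa [add_zero] at h1
  have hpow₂ : (((β₀ ^ p ^ t) ^ h' * aK⁻¹ : (AlgebraicClosure K)ˣ) : AlgebraicClosure K) ^ p ^ k = (x : AlgebraicClosure K) := by
    have hbx' : ((b₀ : F) : AlgebraicClosure K) ^ h' = (a : AlgebraicClosure K) ^ p ^ k * (x : AlgebraicClosure K) := by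
      have := congrArg (fun z : F ↦ (z : AlgebraicClosure K)) hbx
      simpa only [SubmonoidClass.coe_pow, MulMemClass.coe_mul] using this
    have e1 : (β₀ ^ p ^ t) ^ p ^ k = β₀ ^ p ^ (k + t) := by rw [← pow_mul, ← pow_add, add_comm]
    have e2 : ((β₀ ^ p ^ t) ^ h') ^ p ^ k = (β₀ ^ p ^ (k + t)) ^ h' := by rw [pow_right_comm, e1]
    have e3 : ((β₀ ^ p ^ t) ^ h' * aK⁻¹) ^ p ^ k = (β₀ ^ p ^ (k + t)) ^ h' * (aK ^ p ^ k)⁻¹ := by rw [mul_pow, e2, inv_pow]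
    rw [← Units.val_pow_eq_pow_val, e3]
    simp only [Units.val_mul, Units.val_inv_eq_inv_val, Units.val_pow_eq_pow_val]
    rw [hb₀, hbx']
    change (a : AlgebraicClosure K) ^ p ^ k * (x : AlgebraicClosure K) * ((a : AlgebraicClosure K) ^ p ^ k)⁻¹ = _
    rw [mul_comm ((a : AlgebraicClosure K) ^ p ^ k) (x : AlgebraicClosure K), mul_inv_cancel_right₀ (pow_ne_zero _ haK0)]
  -- `m h' ≡ 1 (mod p^k)`: `y_k = (h' m)·y_k` is the class of the `m`-th power, a root of `x^m`
  have hcop : Nat.Coprime h' (p ^ k) := Nat.Coprime.pow_right k ((Nat.Prime.coprime_iff_not_dvd hp).mpr hndvd).symm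
  let m : ℕ := ((ZMod.unitOfCoprime h' hcop)⁻¹ : (ZMod (p ^ k))ˣ).val.val
  have hNM : ((h' : ZMod (p ^ k)) * (m : ZMod (p ^ k))) = 1 := by
    change ((h' : ZMod (p ^ k)) * ((((ZMod.unitOfCoprime h' hcop)⁻¹ : (ZMod (p ^ k))ˣ).val.val : ℕ) : ZMod (p ^ k))) = 1
    rw [ZMod.natCast_zmod_val, ← ZMod.coe_unitOfCoprime h' hcop, Units.mul_inv]
  have hc₃ : IsTwistedKummerClass p θ S (galFixing K F) k (((β₀ ^ p ^ t) ^ h' * aK⁻¹) ^ m) (y k) := by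
    have h1 := TwistedZeta.isTwistedKummerClass_pow p S θ k (galFixing K F) hc₂ m
    rwa [← mul_nsmul, mul_nsmul_levelCoh_eq_self p S θ k (galFixing K F) hNM] at h1
  refine ⟨x ^ m, ((β₀ ^ p ^ t) ^ h' * aK⁻¹) ^ m, pow_ne_zero _ hx0, fun w hw ↦ by rw [map_pow, hxT w hw, one_pow], ?_, ?_, hc₃⟩
  · rw [Units.val_pow_eq_pow_val, ← pow_mul, mul_comm m, pow_mul, hpow₂, SubmonoidClass.coe_pow]
  · intro τ hτ
    have haτ : τ • aK = aK := smul_units_eq_self_of_mem_galFixing (hNF hτ) haKF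
    rw [smul_pow', smul_mul', smul_pow', smul_pow', hβ₀N τ hτ, smul_inv', haτ]

/-! ## §3. Towers consist of classes of roots of `S`-units -/

/-- **A `k`-TOWER OF CLASSES OF `H¹(G_S(F), μ_{p^k} ⊗ θ′)` CONSISTS OF TWISTED KUMMER CLASSES OF ROOTS OF `S`-UNITS OF `F`.** Setting: `F ⊆ K̄` a number field containing `K` with `N_S ≤ Gal(K̄/F)` (`F ⊆ K_S`) and `θ′|_{Gal(K̄/F)} = 1`; `(y_k)_k` with
`red(y_{k+1}) = y_k`. Then for every `k` there are `ε ∈ F^×` with `w.valuation F ε = 1` at every place `w` of `F` not above `S` (an `S`-unit) and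
`β ∈ K̄ˣ` fixed by `N_S` with `β^{p^k} = ε`, such that `y_k` is the twisted Kummer class of `β`. (§2 with `T = {w ∣ S}`: at every depth `j`, `y_j` is
the class of a radical `β_j ∈ K_S` with `β_j^{p^j} = b_j ∈ F` — FILE 7a — and `p^j ∣ ord_w b_j` off `S` because `F(β_j)/F` is unramified off `S`,
tree `dvd_log_valuation_of_pow_eq_of_forall_smul_eq`.) The `Cl_S(F)`-term of the Kummer sequence
`0 → 𝒪_{F,S}^×/p^k → H¹(G_S(F), μ_{p^k}) → Cl_S(F)[p^k] → 0` dies in `lim←_k`.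
[cite: NeukirchSchmidtWingberg2008, VIII §3 Prop. (8.3.4)] [cite: JohnsonLeungKings2011, Cor. 3.4 (arXiv p0010:L40–46)] [cite: SerreLocalFields1979, X §3 b)] -/
theorem exists_sUnit_isTwistedKummerClass_of_tower
    (F : IntermediateField K (AlgebraicClosure K)) [NumberField F]
    (hNF : ramificationSubgroup K S ≤ galFixing K F) (hθF : ∀ σ ∈ galFixing K F, θ σ = 1)
    (y : ∀ k : ℕ, levelCoh p S θ (galFixing K F) k 1) (hy : ∀ k, levelRed p S θ (galFixing K F) k 1 (y (k + 1)) = y k) (k : ℕ) :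
    ∃ (ε : F) (β : (AlgebraicClosure K)ˣ), ε ≠ 0 ∧
      (∀ w : HeightOneSpectrum (𝓞 F), w.under (𝓞 K) ∉ S → w.valuation F ε = 1) ∧
      (β : AlgebraicClosure K) ^ p ^ k = (ε : AlgebraicClosure K) ∧ (∀ τ ∈ ramificationSubgroup K S, τ • β = β) ∧
      IsTwistedKummerClass p θ S (galFixing K F) k β (y k) := by
  have hdiv : ∀ j : ℕ, ∃ (β : (AlgebraicClosure K)ˣ) (b : F), b ≠ 0 ∧ (β : AlgebraicClosure K) ^ p ^ j = (b : AlgebraicClosure K) ∧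
      (∀ τ ∈ ramificationSubgroup K S, τ • β = β) ∧ IsTwistedKummerClass p θ S (galFixing K F) j β (y j) ∧
      ∀ w : HeightOneSpectrum (𝓞 F), w ∉ {w : HeightOneSpectrum (𝓞 F) | w.under (𝓞 K) ∈ S} →
        ((p ^ j : ℕ) : ℤ) ∣ log (w.valuation F b) := by
    intro j
    obtain ⟨β, b, hb, hβN, hc⟩ := exists_isTwistedKummerClass_eq p S θ j F hθF (y j)
    have hβN' : ∀ τ ∈ ramificationSubgroup K S, τ • β = β := fun τ hτ ↦ hβN τ hτ (hNF hτ)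
    have hb' : (β : AlgebraicClosure K) ^ p ^ j = (b : AlgebraicClosure K) := hb.symm
    have hbne : b ≠ 0 := by
      intro h0
      rw [h0] at hb'
      exact (pow_ne_zero _ β.ne_zero) hb'
    refine ⟨β, b, hbne, hb', hβN', hc, fun w hw ↦ ?_⟩
    exact dvd_log_valuation_of_pow_eq_of_forall_smul_eq K F hNF (fun g hg ↦ by rw [← Units.coe_smul, hβN' g hg]) (p ^ j) hbne hb' w hw
  obtain ⟨ε, β, hε0, hεT, hβε, hβN, hc⟩ :=
    exists_isTwistedKummerClass_root_of_forall_dvd p S θ F hNF {w | w.under (𝓞 K) ∈ S} y hy hdiv k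
  exact ⟨ε, β, hε0, fun w hw ↦ hεT w hw, hβε, hβN, hc⟩

end Summit.BirchSwinnertonDyer.BirchSwinnertonDyer.Theorems.PrintCf2.RowTwo

end
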